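import Mathlib.RingTheory.KrullDimension.Basic
import Mathlib.RingTheory.RegularLocalRing.Defs
import Mathlib.RingTheory.UniqueFactorizationDomain.Defs
import Literature.AlgebraicGeometry.Resolution.QuadraticTransforms
import HarnessLib

/-!
# Heinzer–Loper–Olberding–Schoutens–Toeniskoetter: the Noetherian hull `S[1/x]` of a Shannon
# extension `S = ⋃ R_i` is a unique factorisation domain (arXiv:1505.06445, Thm. 4.1 (1))

Topic: `Literature/AlgebraicGeometry/Resolution`. NAMED FACT, sibling of
`HeinzerEtAl2015ShannonValuationRankTwo` (`ShannonValuationRankTwo.lean`, whose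
`-- TODO(general form)` names Theorem 4.1 as wanted). Filed for the cell `res-hironaka`, rung L,
slot W4.1, crux `Steer` `stmt-ResolutionOfSingularities-16345`, idea-2 card 3 support statement L5
`ResonanceAlternative` (res-L0-w41-plan-1 UNCLAIMED-STUB LIST 2026-08-27T08:41:57Z U4 «in print:
hull is a UFD, essential primes = height-one primes — HLOST Thm 4.1, Prop 4.4»; consumer = the
Theorems file `FrobeniusClosingSteerResonanceAlternative.lean`, which proves L5 from this fact by
unique-factorisation bookkeeping).

## What the source prints (arXiv:1505.06445 = W. Heinzer, K. A. Loper, B. Olberding, H. Schoutens,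
## M. Toeniskoetter, «Ideal theory of infinite directed unions of local quadratic transforms»,
## J. Algebra 474 (2017) 213–239; pages read 2026-08-27 on the held copy `paper:arxiv-1505.06445`)

* **Setting 3.1** (chunk p0007, PDF p. 7), VERBATIM: «We make the following assumptions throughout
  the rest of the paper. (1) `(R, 𝔪)` is a regular local ring with quotient field `F` such that
  `dim R ≥ 2`. (2) `{(R_i, 𝔪_i)}` is an infinite sequence of local quadratic transforms of regular
  local rings starting from `R_0 = R`. That is, for each `i > 0`, `R_i` is a local quadratic transform
  of `R_{i-1}`, so `R_i` is a regular local ring, `R_{i-1} ⊊ R_i`, and, by Remark (dim remark),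
  `dim R_{i-1} ≥ dim R_i ≥ 2`. (3) `S = ⋃_{i=0}^∞ R_i` is the Shannon extension of `R` along `{R_i}`
  and `N = ⋃_{i=0}^∞ 𝔪_i` is the maximal ideal of `S`.»
* **Proposition 3.8** (chunk p0008), VERBATIM: «Assuming Setting 3.1, there exists a regular
  parameter `x` in one of the `R_i`'s such that `xR_{i+1} = 𝔪_iR_{i+1}` and `xS` is an `N`-primary
  ideal of `S`.»
* **Theorem 4.1** (chunk p0009, PDF p. 9), VERBATIM: «Assuming Setting 3.1, let `T` be the
  intersection of all the DVRs with quotient field `F` that properly contain `S`, where an empty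
  intersection equals `F`. Then the following statements hold for `T`. (1) `T = S[1/x]` for any
  `x ∈ N` such that `xS` is `N`-primary. Furthermore, `T` is a localization of `R_i` for `i ≫ 0`. In
  particular, `T` is a UFD. (2) […] (3) The ring `T` is a Noetherian regular ring that is the unique
  minimal proper Noetherian overring of `S` in `F`.»; proof, first line: «If `S` is a DVR, then `T` is
  the quotient field of `S` and the assertions (1), (2) and (3) hold».  Definition 4.2 (same chunk):
  `T` is «the Noetherian hull of the Shannon extension `S`».

## Print placement of the form below (why it is WEAKER than print)

Data inside one field `K`: `O` a valuation ring of `K`; `R : ℕ → Subring K` with `R 0` a regular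
local ring of Krull dimension `≥ 2`, dominated by `O`; every `R (i+1)` the quadratic transform of
`R i` ALONG `O` (`IsQuadraticTransformAlong`, Cutkosky §2.2 — the tree's notion, a local quadratic
transform in the sense of print by `IsQuadraticTransformAlong.isQuadraticTransform`); all members of
dimension `≥ 2` (Setting 3.1 (2); then `R i ⊊ R (i+1)`, the sequence is infinite and `S := ⨆ R i`
is the Shannon extension of `R 0` along `O`, Setting 3.1 (3)) — exactly the data of the sibling fact
`HeinzerEtAl2015ShannonValuationRankTwo`.  The element `x`: «`x ∈ N`» is rendered as `x ∈ S` with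
`v_O(x) < 1` (every member is dominated by `O`, `IsQuadraticTransformAlong.dominated`, so the
maximal ideal `N = ⋃ 𝔪_i` of `S` is `{a ∈ S : v_O(a) < 1}`), and «`xS` is `N`-primary» as
«`N ⊆ √(xS)`»: every `a ∈ S` with `v_O(a) < 1` has a power `a^m = s·x` with `s ∈ S` (given `x ∈ N`
this is equivalent to `√(xS) = N`, i.e. `xS` `N`-primary, `S` being local with maximal ideal `N`).
Conclusion: ONLY the clause «`T` is a UFD» of (1), for `T := S[1/x]` realised as the subring of `K`
generated by `S` and `x⁻¹` (`= {s/x^m}`); the clauses «localization of `R_i`», (2), (3) are NOT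
asserted (weaker than print).  Ambient field: print works in the quotient field `F` of `R`; here `K`
is any field containing the sequence — every member `R i`, the union `S`, `x⁻¹` and `T` lie in the
quotient field of `R 0` inside `K` (elements of a quadratic transform are quotients of elements of
the previous member), and along `O ∩ Frac(R 0)` the `R i` are the same quadratic transforms, so the
form below is the printed statement read inside `K` (the ring `T` is the same).  NOT in print and
NOT claimed: anything for sequences not along a dominating valuation ring, or with a member of
dimension `≤ 1`.

-- TODO(general form): Theorem 4.1 in full — `T = ⋂ {DVRs ⊋ S}`, `T` a localization of `R_i` for
-- `i ≫ 0`, Noetherian regular, the unique minimal proper Noetherian overring (the «Noetherian hull»,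
-- Def. 4.2), and Proposition 4.4 (`a ∈ T^×` iff the transforms `(aR_n)^{R_i}` become trivial) —
-- needs the Noetherian hull as a tree object.

References: W. Heinzer, K. A. Loper, B. Olberding, H. Schoutens, M. Toeniskoetter, *Ideal theory of
infinite directed unions of local quadratic transforms*, J. Algebra 474 (2017) 213–239
(= arXiv:1505.06445), Setting 3.1, Prop. 3.8, Thm. 4.1 (1), Def. 4.2 [HeinzerEtAl2015];
S. D. Cutkosky (2014), §2.1–2.2 (the tree's `QuadraticTransforms.lean`) [Cutkosky2014].
-/

noncomputable section

namespace Literature.AlgebraicGeometry.Resolution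

open IsLocalRing

universe u

/-- NAMED FACT — **Heinzer–Loper–Olberding–Schoutens–Toeniskoetter 2017, Theorem 4.1 (1), the
clause «`T = S[1/x]` is a UFD», for the Shannon extension along a dominating valuation ring**
(chunk p0009: «(1) `T = S[1/x]` for any `x ∈ N` such that `xS` is `N`-primary. Furthermore, `T` is
a localization of `R_i` for `i ≫ 0`. In particular, `T` is a UFD.», in Setting 3.1, chunk p0007).
Data, inside one field `K`: `O : ValuationSubring K`; `R : ℕ → Subring K` with `R 0` regular local,
dominated by `O`, every member of Krull dimension `≥ 2` (Setting 3.1), each `R (i+1)` the quadratic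
transform of `R i` ALONG `O` (`IsQuadraticTransformAlong`); `S := ⨆ R i` (the Shannon extension);
`x ∈ S` with `v_O(x) < 1` («`x ∈ N`») such that every `a ∈ S` with `v_O(a) < 1` has a power
`a^m = s·x`, `s ∈ S` («`xS` is `N`-primary»).  Conclusion: the subring `T` of `K` generated by `S`
and `x⁻¹` (`= S[1/x]`) is a unique factorisation monoid.  The reduction of this form to the printed
statement (and why it is weaker) is the paragraph «Print placement» of the module docstring.
Users take `(h : HeinzerEtAl2015NoetherianHullUFD)`.
[cite: HeinzerEtAl2015, Thm. 4.1 (1), Setting 3.1, Prop. 3.8, Def. 4.2] [cite: Cutkosky2014, §2.2] -/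
def HeinzerEtAl2015NoetherianHullUFD : Prop :=
  ∀ (K : Type u) [Field K] (O : ValuationSubring K) (R : ℕ → Subring K),
    IsRegularLocalRing (R 0) →
    (∀ i, (2 : WithBot ℕ∞) ≤ ringKrullDim (R i)) →
    SubringDominates (R 0) O.toSubring →
    (∀ i, IsQuadraticTransformAlong O (R i) (R (i + 1))) →
    ∀ x : K, x ∈ (⨆ i, R i : Subring K) → O.valuation x < 1 →
      (∀ a : K, a ∈ (⨆ i, R i : Subring K) → O.valuation a < 1 →
        ∃ (m : ℕ) (s : K), s ∈ (⨆ i, R i : Subring K) ∧ a ^ m = s * x) →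
      UniqueFactorizationMonoid (Subring.closure (((⨆ i, R i : Subring K) : Set K) ∪ {x⁻¹}))

end Literature.AlgebraicGeometry.Resolution

end
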